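import Summits.HubbardSuperconductivity.HubbardSuperconductivity.Theorems.AnisotropyChordTransferFibre3Hole2Quarter

/-!
# Route `AnisotropyChord` / H0 rotor rung: HOLE₂(.75) at `L = 20` — kernel facts, part b (32 of the 65 `D₄`-classes)

KERNEL FACT for the twice-punctured `20 × 20` torus (zero data): the quarter-table interval Birman–Schwinger checker `Hole2.checkRepsQ`
(`…Fibre3Hole2Quarter`) accepts the listed separations at the certified constant `g_20 ≥ ¾ε₁(20)`, by ONE `decide +kernel`
(`maxHeartbeats 400000` pre-budgeted: the quarter Green table alone is ¾L³ interval operations, recomputed in each part).  The parts are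
glued in `…Hole2L20` (`checkRepsQ_append`) and turned into `TwoHoleGap 20 (3/4·eps1 20)` by `Hole2.twoHoleGap_of_checkRepsQ`.
Prover seat `hubbard-h0-rotor-p3` g3; helper for stmt-HubbardSuperconductivity-19089 (`--supports`, helper class).
WHAT THIS IS NOT: nothing here proves superconductivity in the Hubbard model (rotor TARGET as worded stays FALSE, g15 verdict);
kernel facts for ONE input (HOLE₂(.75) at one `L`) of ONE conditional reduction (rung 19089). Tree imports only; no sorry, no `native_decide`.
-/

set_option linter.dupNamespace false
set_option autoImplicit false

namespace Summit.HubbardSuperconductivity.HubbardSuperconductivity.Theorems.AnisotropyChord.Transfer.Fibre3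

namespace Hole2

/-- `D₄`-representatives of the nonzero separations of the `20 × 20` torus, part b. [folklore] -/
def reps20b : List (ℕ × ℕ) := [(7, 6), (7, 7), (8, 0), (8, 1), (8, 2), (8, 3), (8, 4), (8, 5), (8, 6), (8, 7), (8, 8), (9, 0), (9, 1), (9, 2), (9, 3), (9, 4), (9, 5), (9, 6), (9, 7), (9, 8), (9, 9), (10, 0), (10, 1), (10, 2), (10, 3), (10, 4), (10, 5), (10, 6), (10, 7), (10, 8), (10, 9), (10, 10)]

set_option maxHeartbeats 400000 in
/-- kernel fact: part b passes the quarter-table interval Birman–Schwinger test at `g_20 ≥ ¾ε₁(20)`. [folklore] -/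
theorem checkRepsQ_20b : checkRepsQ 20 reps20b = true := by
  decide +kernel

end Hole2

end Summit.HubbardSuperconductivity.HubbardSuperconductivity.Theorems.AnisotropyChord.Transfer.Fibre3
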